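import Summits.Parity.GeneralizedHardyLittlewood.Theses.LiouvilleShiftedTables
import Summits.Parity.GeneralizedHardyLittlewood.Theorems.TableChowla.Negative.TableChowlaPretenders

/-!
# `TableChowla` (stmt-Parity-14270) FAILS for every real-character-like function at the shift
# `c = q` — the Landau–Siegel ghost at every modulus dividing the shift

Negative lemma for the crux `LiouvilleShiftedTables.TableChowla` (cdisprove seat), generalising
`TableChowlaPretenders`: `not_tableChowlaFor_unitChar` — for every `q ≥ 1` and every
`χ : ℕ → ℝ` that is `q`-periodic, completely multiplicative and satisfies `χ² = 𝟙_{(·,q)=1}`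
(every real Dirichlet character mod `q`, the principal one included), the crux shape
`TableChowlaFor χ` is false: at `c = q` the table is rank one, `χ(ab+q) = χ(a)χ(b)`, and at
`x = (qn)¹²`, `A = qn` its fourth moment is `(φ(q)/q)⁴·x²` (unit counting `sum_unitInd_Ico`),
not `≤ x²/(12 log(qn))`. Instance: `not_tableChowlaFor_principal` (the `χ₄` case is `not_tableChowlaFor_chi4` of `TableChowlaPretenders`).
Moral: a proof for `λ` must use non-pretentiousness of `λ` to EVERY real character of conductor
dividing the shift, with a `(log x)^C` margin for every `C`. [folklore]
-/

namespace Summit.Parity.GeneralizedHardyLittlewood.Theorems.TableChowla.Negative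

open Finset Real ArithmeticFunction
open Summit.Parity.GeneralizedHardyLittlewood.Theses

noncomputable section

/-- Unit count in `k` consecutive blocks of length `q`: `Σ_{n ∈ [N, N+qk)} χ(n)² = k·φ(q)`. -/
theorem sum_unitInd_Ico {q : ℕ} (χ : ℕ → ℝ) (hsq : ∀ n, χ n ^ 2 = if q.Coprime n then 1 else 0)
    (N k : ℕ) : ∑ n ∈ Ico N (N + q * k), χ n ^ 2 = k * Nat.totient q := by
  induction k with
  | zero => simp
  | succ k ih =>
    rw [show N + q * (k + 1) = (N + q * k) + q by ring,
      ← Finset.sum_Ico_consecutive _ (Nat.le_add_right N (q * k)) (Nat.le_add_right _ q), ih]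
    have hblock : ∑ n ∈ Ico (N + q * k) (N + q * k + q), χ n ^ 2 = Nat.totient q := by
      simp_rw [hsq]
      rw [Finset.sum_boole, Nat.filter_coprime_Ico_eq_totient]
    rw [hblock]
    push_cast
    ring

/-- **Every real character-like `χ` mod `q` fails the crux at the shift `c = q`.** -/
theorem not_tableChowlaFor_unitChar {q : ℕ} (hq : 1 ≤ q) (χ : ℕ → ℝ)
    (hper : ∀ n, χ (n + q) = χ n) (hmul : ∀ a b, χ (a * b) = χ a * χ b)
    (hsq : ∀ n, χ n ^ 2 = if q.Coprime n then 1 else 0) : ¬ TableChowlaFor χ := by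
  intro h
  have hq0 : (q : ℤ) ≠ 0 := by exact_mod_cast (show q ≠ 0 by omega)
  obtain ⟨x₀, hx₀⟩ := h q hq0 (1 / 12) (by norm_num) le_rfl 1 one_pos
  obtain ⟨n, hn⟩ := exists_nat_ge (max x₀ (max 2 (Real.exp ((q : ℝ) ^ 4))))
  have hnx : x₀ ≤ n := le_trans (le_max_left _ _) hn
  have hn2 : (2 : ℝ) ≤ n := le_trans (le_trans (le_max_left _ _) (le_max_right _ _)) hn
  have hne : Real.exp ((q : ℝ) ^ 4) ≤ n := le_trans (le_trans (le_max_right _ _) (le_max_right _ _)) hn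
  have hnpos : (0 : ℝ) < n := by linarith
  have hq1 : (1 : ℝ) ≤ q := by exact_mod_cast hq
  set m : ℕ := q * n with hm
  have hm1 : (1 : ℝ) ≤ m := by rw [hm]; push_cast; nlinarith
  have hm1' : 1 ≤ m := by exact_mod_cast hm1
  have hm0 : m ≠ 0 := by omega
  have hmpos : (0 : ℝ) < m := by linarith
  have hnm : (n : ℝ) ≤ m := by rw [hm]; push_cast; nlinarith
  have hxx₀ : x₀ ≤ (m : ℝ) ^ 12 := (hnx.trans hnm).trans (le_self_pow₀ hm1 (by norm_num))
  obtain ⟨hw1, hw2⟩ := window_pow (k := 12) (by norm_num) hm1'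
  have key := hx₀ ((m : ℝ) ^ 12) hxx₀ m (by exact_mod_cast hw1) (by exact_mod_cast hw2)
  rw [moment_pow χ q (by norm_num) hm0, momentN_of_rankOne (f := χ) (c := q) χ χ ?_,
    Real.rpow_one, Real.log_pow] at key
  swap
  · intro a _ b _
    rw [show ((a : ℤ) * (b : ℕ) + (q : ℕ)) = ((a * b + q : ℕ) : ℤ) by push_cast; ring, Int.toNat_natCast,
      hper, hmul]
  -- rows: Ioc m (2m) = Ico (m+1) (m+1 + q*n) ; cols: Icc 1 (m^11) = Ico 1 (1 + q*(q^10 n^11))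
  have hrows : ∑ a ∈ Ioc m (2 * m), χ a ^ 2 = n * Nat.totient q := by
    have e : Ioc m (2 * m) = Ico (m + 1) ((m + 1) + q * n) := by
      ext a; simp only [mem_Ioc, mem_Ico]; rw [← hm]; omega
    rw [e]
    exact sum_unitInd_Ico χ hsq _ _
  have hcols : ∑ b ∈ Icc 1 (m ^ (12 - 1)), χ b ^ 2 = ((q ^ 10 * n ^ 11 : ℕ) : ℝ) * Nat.totient q := by
    have e1 : m ^ (12 - 1) = q * (q ^ 10 * n ^ 11) := by rw [hm]; norm_num; ring
    have e : Icc 1 (m ^ (12 - 1)) = Ico 1 (1 + q * (q ^ 10 * n ^ 11)) := by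
      rw [e1]; ext b; simp only [mem_Icc, mem_Ico]; omega
    rw [e]
    exact_mod_cast sum_unitInd_Ico χ hsq 1 (q ^ 10 * n ^ 11)
  rw [hrows, hcols] at key
  push_cast at key
  -- sizes
  have hφ1 : (1 : ℝ) ≤ Nat.totient q := by exact_mod_cast Nat.totient_pos.mpr (by omega)
  set φr : ℝ := (Nat.totient q : ℝ) with hφr
  have hP : (0 : ℝ) < ((n : ℝ) * φr) ^ 2 * ((q : ℝ) ^ 10 * (n : ℝ) ^ 11 * φr) ^ 2 := by positivity
  refine absurd_of_le_div hP (κ := (q : ℝ) ^ 4 / φr ^ 4) ?_ (by positivity) ?_ key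
  · rw [hm, div_mul_eq_mul_div, le_div_iff₀ (by positivity)]
    push_cast
    apply le_of_eq; ring
  · -- q⁴/φ⁴ ≤ q⁴ < 12 q⁴ ≤ 12 log n ≤ 12 log m
    have hlogn : (q : ℝ) ^ 4 ≤ Real.log n := (Real.le_log_iff_exp_le hnpos).mpr hne
    have hlogm : Real.log n ≤ Real.log m := Real.log_le_log hnpos hnm
    have hκ : (q : ℝ) ^ 4 / φr ^ 4 ≤ (q : ℝ) ^ 4 := div_le_self (by positivity) (one_le_pow₀ hφ1)
    have hq4 : (1 : ℝ) ≤ (q : ℝ) ^ 4 := one_le_pow₀ hq1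
    nlinarith

/-- Instance: the PRINCIPAL character `𝟙_{(n,q)=1}` for every `q ≥ 1` (`q = 2`: the gen-1
pretender `𝟙_odd`; `q = 1`: the ghost `f ≡ 1`). -/
theorem not_tableChowlaFor_principal {q : ℕ} (hq : 1 ≤ q) :
    ¬ TableChowlaFor (fun n => if q.Coprime n then 1 else 0) := by
  refine not_tableChowlaFor_unitChar hq _ (fun n => ?_) (fun a b => ?_) (fun n => ?_)
  · simp only [Nat.coprime_add_self_right]
  · by_cases ha : q.Coprime a <;> by_cases hb : q.Coprime b
    · rw [if_pos (Nat.coprime_mul_iff_right.mpr ⟨ha, hb⟩), if_pos ha, if_pos hb, one_mul]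
    · rw [if_neg (fun h => hb (Nat.coprime_mul_iff_right.mp h).2), if_pos ha, if_neg hb, mul_zero]
    · rw [if_neg (fun h => ha (Nat.coprime_mul_iff_right.mp h).1), if_neg ha, if_pos hb, zero_mul]
    · rw [if_neg (fun h => ha (Nat.coprime_mul_iff_right.mp h).1), if_neg ha, if_neg hb, zero_mul]
  · by_cases h : q.Coprime n <;> simp [h]

end

end Summit.Parity.GeneralizedHardyLittlewood.Theorems.TableChowla.Negative
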